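import Summits.QuantumFields.YangMills.Theorems.ColdStartUniversalityShenZhuZhuLinkFieldSU2
import Summits.QuantumFields.YangMills.Theorems.ColdStartUniversalityLatticeLangevinLipschitzFunctionalInequalities
import Summits.QuantumFields.YangMills.Theorems.ColdStartUniversalityLatticeLangevinDynkinForward
import Summits.QuantumFields.YangMills.Theorems.ColdStartUniversalityLatticeLangevinMeasurableFlow
import Literature.MathematicalPhysics.QuantumFieldTheory.LatticeGaugeProofs
import Literature.MathematicalPhysics.QuantumFieldTheory.LatticeGaugeStaticPotentialProofs
import Literature.MathematicalPhysics.QuantumFieldTheory.ShenZhuZhuPoincareApplications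
import HarnessLib

/-!
# Shen–Zhu–Zhu's Corollary 4.7 (the SUSCEPTIBILITY SUM of the link field) for `SU(2)` lattice Yang–Mills in three dimensions:
# `0 ≤ Σ_e Cov_{L,β'}(⟨Q_{e₀},E⟩, ⟨Q_e,E⟩) ≤ ‖E‖_F²/(1 − 12|β'|)` on every torus, and the named fact `shenZhuZhu_linkSusceptibility 3 2`

Seat `ym-line-csu-p1` (g39), route `ColdStartUniversality` of `Summits/QuantumFields/YangMills`, helper file G19 (fixed cut-off, strong
coupling; `--supports stmt-QuantumFields-24809`).  The Literature vendors Shen–Zhu–Zhu's Corollary 4.7 (CMP 400 (2023) = arXiv:2204.12737,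
p. 20–21) as the NAMED FACT `shenZhuZhu_linkSusceptibility d N` (`ShenZhuZhuPoincareApplications`, a `def … : Prop`).  Its proof has two
inputs: the Poincaré inequality (4.11) for `f = |E⁺|^{-1/2} Σ_e ⟨Q_e,E⟩` and the invariance of the periodic measure under the lattice
symmetries, which act transitively on the positively oriented links.  Both are in the tree: the seat's volume-uniform Lipschitz-form
Poincaré inequality on the torus (`wilson_variance_le_of_linkLipschitz_uniform`, g38, `K = 1 − 12|β'|`) and the invariance of Wilson's torus
measure under translations (`wilsonMeasure_map_torusConfigShift`) and axis permutations (`wilsonMeasure_map_configPerm`).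

* §1 `sum_covariance_eq_of_symmetry` — abstract: if `Φ` preserves `μ` and relabels a family `X_i ∘ Φ = X_{σ i}` along a bijection `σ`, then
  `Σ_j Cov(X_i, X_j) = Σ_j Cov(X_{σ i}, X_j)`.
* §2 (every `d`, `L`, compact `G`, continuous `ρ`, every `β`) `sum_covariance_linkObs_translate/perm/eq` — for a one-link observable `g(U_e)` the
  row sums `Σ_e Cov_{μ_{L,β}}(g(U_{e₀}), g(U_e))` do not depend on `e₀` ((ℤ/L)^d ⋊ S_d acts transitively on links);
  `variance_sum_linkObs_eq` — `Var(Σ_e g(U_e)) = |E⁺|·Σ_e Cov(g(U_{e₀}), g(U_e))`.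
* §3 (`SU(2)`, `d = 3`, `|β'| < 1/12`) `re_trace_mul_conjTranspose_eq_sum`, ★ `torus_linkFieldSum_variance_su2` —
  `Var_{L,β'}(Σ_e ⟨Q_e,E⟩) ≤ |E⁺|·‖E‖_F²/(1 − 12|β'|)` (the total link field is `‖E‖_F`-Lipschitz in every link).
* §4 ★★★ `torus_linkSusceptibility_su2` — `0 ≤ Σ_e Cov_{L,β'}(⟨Q_{e₀},E⟩,⟨Q_e,E⟩) ≤ ‖E‖_F²/(1 − 12|β'|)` for EVERY `L`, every link `e₀`, every
  matrix `E`; ★★ `torus_linkSusceptibility_offDiag_su2` — `|Σ_{e ≠ e₀} Cov(…)| ≤ ‖E‖_F²/(1 − 12|β'|)`.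
* §5 ★★★ `szzLinkSusceptibilityBound_su2` (`SZZLinkSusceptibilityBound (fundamentalRep (Fin 2)) 3 (2β) 2 K` for `|β| < 1/24`, `0 < K ≤ 1 − 24|β|`) and
  the NAMED FACT ★★★ `shenZhuZhu_linkSusceptibility_su2_d3 : shenZhuZhu_linkSusceptibility 3 2` (SZZ window `|β| < 1/32`, printed constants
  `2/K_S`, `4/K_S`, `K_S = 1 − 32|β|`; the `SO(2)` conjunct is vacuous since SZZ's threshold `1/(32(d−1)) − 1/(16N(d−1))` vanishes at `N = 2`).

THEOREMS ONLY, no definition, no sorry.  HONEST FRAMING: this discharges a vendored LITERATURE statement at STRONG coupling for ONE group and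
dimension (`SU(2)`, `d = 3`) on FIXED finite tori; nothing at weak coupling / in the continuum, nothing `K`-uniform along the route's scaling
(`UniformColdStartMixing`, 24809, ASIDE, not restated); no crux, rung or summit statement is proved; the Yang–Mills mass gap is NOT proved.

References: H. Shen, R. Zhu, X. Zhu, CMP 400 (2023) 805–851 = arXiv:2204.12737, Cor. 4.7 (p. 20–21), Cor. 4.4 (4.11), (2.3) [ShenZhuZhu2022];
E. Seiler, LNP 159 (1982) Ch. 1 (hypercubic invariance of the Wilson action and of product Haar measure).
-/

set_option autoImplicit false

noncomputable section

namespace Summit.QuantumFields.YangMills.Theorems.ColdStartUniversality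

open MeasureTheory ProbabilityTheory Finset Filter Set Function
open scoped BigOperators NNReal ENNReal Topology Matrix
open Literature.MathematicalPhysics.QuantumFieldTheory
open Literature.MathematicalPhysics.QuantumLattice (fundamentalRep fundamentalLatticeRep continuous_fundamentalRep fundamentalRep_apply)

/-! ## §1. Covariance row sums under a measure-preserving relabelling -/

/-- **Row sums of the covariance matrix are constant along a measure-preserving symmetry.**  If `Φ : Ω ≃ᵐ Ω` preserves `μ` and relabels
the family, `X_i ∘ Φ = X_{σ i}` for a bijection `σ` of the index set, then `Σ_j Cov_μ(X_i, X_j) = Σ_j Cov_μ(X_{σ i}, X_j)` (change of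
variables in each covariance, then re-indexing of the sum). [folklore] -/
theorem sum_covariance_eq_of_symmetry {Ω ι : Type*} [MeasurableSpace Ω] [Fintype ι] {μ : Measure Ω}
    (Φ : Ω ≃ᵐ Ω) (hΦ : μ.map Φ = μ) (σ : ι ≃ ι) (X : ι → Ω → ℝ) (hX : ∀ i, X i ∘ Φ = X (σ i)) (i : ι) :
    ∑ j, cov[X i, X j; μ] = ∑ j, cov[X (σ i), X j; μ] := by
  calc ∑ j, cov[X i, X j; μ] = ∑ j, cov[X i, X j; μ.map Φ] := by rw [hΦ]
    _ = ∑ j, cov[X (σ i), X (σ j); μ] := by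
        refine Finset.sum_congr rfl fun j _ => ?_
        rw [covariance_map_equiv, hX, hX]
    _ = ∑ j, cov[X (σ i), X j; μ] := σ.sum_comp (fun j => cov[X (σ i), X j; μ])

/-! ## §2. One-link observables under Wilson's torus measure: the row sums do not depend on the link -/

section LinkSymmetry

variable {d L N : ℕ} [NeZero L] {G : Type*} [Group G] [TopologicalSpace G] [IsTopologicalGroup G] [CompactSpace G]
  [MeasurableSpace G] [BorelSpace G] (ρ : G →* Matrix (Fin N) (Fin N) ℂ)

/-- **Translations**: for a one-link observable `g(U_e)` under Wilson's torus measure `μ_{L,β}`, the covariance row sum at the link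
`e₀ = (x₀, i)` equals the row sum at `(x, i)` for every site `x` (translation invariance `wilsonMeasure_map_torusConfigShift`). [folklore] -/
theorem sum_covariance_linkObs_translate (β : ℝ) (g : G → ℝ) (e₀ : Edge d L) (x : Site d L) :
    ∑ e, cov[fun U : GaugeConfig d L G => g (U e₀), fun U => g (U e); wilsonMeasure (d := d) (L := L) ρ β] =
      ∑ e, cov[fun U : GaugeConfig d L G => g (U (x, e₀.2)), fun U => g (U e); wilsonMeasure (d := d) (L := L) ρ β] := by
  have h := sum_covariance_eq_of_symmetry (μ := wilsonMeasure (d := d) (L := L) ρ β)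
    (TorusTranslation.torusConfigShift (G := G) (e₀.1 - x)) (wilsonMeasure_map_torusConfigShift ρ β (e₀.1 - x))
    (TorusTranslation.torusEdgeShift (d := d) (L := L) (e₀.1 - x)).symm (fun (e : Edge d L) (U : GaugeConfig d L G) => g (U e))
    (fun e => by
      funext U
      simp only [Function.comp_apply, TorusTranslation.torusConfigShift_apply, TorusTranslation.torusEdgeShift_symm_apply]) e₀
  rw [TorusTranslation.torusEdgeShift_symm_apply, sub_sub_cancel] at h
  exact h

/-- **Axis permutations**: the covariance row sum at `e₀ = (x₀, i₀)` equals the row sum at the link `(π x₀, i₁)`, `π` the transposition of the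
axes `i₀, i₁` acting on sites (invariance `wilsonMeasure_map_configPerm`; continuous `ρ`). [folklore] -/
theorem sum_covariance_linkObs_perm (hρ : Continuous ρ) (β : ℝ) (g : G → ℝ) (e₀ : Edge d L) (i₁ : Fin d) :
    ∑ e, cov[fun U : GaugeConfig d L G => g (U e₀), fun U => g (U e); wilsonMeasure (d := d) (L := L) ρ β] =
      ∑ e, cov[fun U : GaugeConfig d L G => g (U (sitePerm (Equiv.swap e₀.2 i₁) e₀.1, i₁)), fun U => g (U e);
        wilsonMeasure (d := d) (L := L) ρ β] := by
  set π : Equiv.Perm (Fin d) := Equiv.swap e₀.2 i₁ with hπ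
  have h := sum_covariance_eq_of_symmetry (μ := wilsonMeasure (d := d) (L := L) ρ β)
    (configPerm (G := G) (L := L) π) (wilsonMeasure_map_configPerm ρ hρ β π)
    (edgePerm (L := L) π.symm) (fun (e : Edge d L) (U : GaugeConfig d L G) => g (U e))
    (fun e => by
      funext U
      simp only [Function.comp_apply, configPerm_apply, edgePerm, Equiv.prodCongr_apply, Prod.map]) e₀
  have hσ : edgePerm (L := L) π.symm e₀ = (sitePerm (Equiv.swap e₀.2 i₁) e₀.1, i₁) := by
    simp only [edgePerm, Equiv.prodCongr_apply, Prod.map, hπ, Equiv.symm_swap, Equiv.swap_apply_left]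
  rw [hσ] at h
  exact h

/-- **The lattice symmetries act transitively on links**: the covariance row sum `Σ_e Cov_{μ_{L,β}}(g(U_{e₀}), g(U_e))` of a one-link
observable is the same for every link `e₀` (a transposition of axes, then a translation). [folklore] -/
theorem sum_covariance_linkObs_eq (hρ : Continuous ρ) (β : ℝ) (g : G → ℝ) (e₀ e₁ : Edge d L) :
    ∑ e, cov[fun U : GaugeConfig d L G => g (U e₀), fun U => g (U e); wilsonMeasure (d := d) (L := L) ρ β] =
      ∑ e, cov[fun U : GaugeConfig d L G => g (U e₁), fun U => g (U e); wilsonMeasure (d := d) (L := L) ρ β] := by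
  rw [sum_covariance_linkObs_perm ρ hρ β g e₀ e₁.2,
    sum_covariance_linkObs_translate ρ β g (sitePerm (Equiv.swap e₀.2 e₁.2) e₀.1, e₁.2) e₁.1]

omit [NeZero L] [Group G] [IsTopologicalGroup G] in
/-- A continuous one-link observable is square integrable under any finite measure on configurations. [folklore] -/
theorem memLp_two_linkObs {g : G → ℝ} (hg : Continuous g) (e : Edge d L) (μ : Measure (GaugeConfig d L G)) [IsFiniteMeasure μ] :
    MemLp (fun U : GaugeConfig d L G => g (U e)) 2 μ := by
  obtain ⟨C, hC⟩ := (isCompact_univ (X := G)).exists_bound_of_continuousOn hg.continuousOn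
  have hm : Measurable fun U : GaugeConfig d L G => g (U e) := hg.measurable.comp (measurable_pi_apply e)
  exact MemLp.of_bound hm.aestronglyMeasurable C (ae_of_all _ fun U => hC _ (Set.mem_univ _))

/-- **Variance of the total = number of links × one row sum**: `Var_{μ_{L,β}}(Σ_e g(U_e)) = |E⁺_{Λ_L}| · Σ_e Cov(g(U_{e₀}), g(U_e))` for every
link `e₀` (bilinearity and §2's transitivity). [cite: ShenZhuZhu2022, Corollary 4.7] -/
theorem variance_sum_linkObs_eq (hρ : Continuous ρ) (β : ℝ) {g : G → ℝ} (hg : Continuous g) (e₀ : Edge d L) :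
    Var[fun U : GaugeConfig d L G => ∑ e, g (U e); wilsonMeasure (d := d) (L := L) ρ β] =
      (Fintype.card (Edge d L) : ℝ) *
        ∑ e, cov[fun U : GaugeConfig d L G => g (U e₀), fun U => g (U e); wilsonMeasure (d := d) (L := L) ρ β] := by
  haveI : IsProbabilityMeasure (wilsonMeasure (d := d) (L := L) ρ β) := isProbabilityMeasure_wilsonMeasure ρ hρ β
  rw [variance_fun_sum (fun e => memLp_two_linkObs hg e _)]
  rw [Finset.sum_congr rfl (fun e _ => sum_covariance_linkObs_eq ρ hρ β g e e₀), Finset.sum_const, Finset.card_univ,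
    nsmul_eq_mul]

end LinkSymmetry

/-! ## §3. `SU(2)`, `d = 3`: the total link field is `‖E‖_F`-Lipschitz in every link -/

/-- `Re Tr(M Eᴴ) = Σ_{ij} (Re M_{ij} Re E_{ij} + Im M_{ij} Im E_{ij})` — the Hilbert–Schmidt pairing in real coordinates. [cite: ShenZhuZhu2022, (2.3)] -/
theorem re_trace_mul_conjTranspose_eq_sum {N : ℕ} (M E : Matrix (Fin N) (Fin N) ℂ) :
    (M * Eᴴ).trace.re = ∑ i, ∑ j, ((M i j).re * (E i j).re + (M i j).im * (E i j).im) := by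
  simp only [Matrix.trace, Matrix.diag_apply, Matrix.mul_apply, Matrix.conjTranspose_apply, Complex.re_sum,
    Complex.mul_re, Complex.star_def, Complex.conj_re, Complex.conj_im, mul_neg, sub_neg_eq_add]

/-- ★ **Variance of the TOTAL link field on every torus, `|β'| < 1/12`**: `Var_{L,β'}(Σ_e ⟨Q_e,E⟩) ≤ |E⁺_{Λ_L}|·‖E‖_F²/(1 − 12|β'|)` — the sum of
the link fields is `‖E‖_F`-Lipschitz in every link (Cauchy–Schwarz for the Hilbert–Schmidt pairing), and the seat's volume-uniform Lipschitz-form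
Poincaré inequality applies.  The Yang–Mills mass gap is NOT proved. [cite: ShenZhuZhu2022, Corollary 4.7] -/
theorem torus_linkFieldSum_variance_su2 {β' : ℝ} (hβ : |β'| < 1 / 12) (L : ℕ) [NeZero L] (E : Matrix (Fin 2) (Fin 2) ℂ) :
    Var[fun V : GaugeConfig 3 L (Matrix.specialUnitaryGroup (Fin 2) ℂ) => ∑ e, linkHSComponent (fundamentalRep (Fin 2)) E e V;
        wilsonMeasure (d := 3) (L := L) (fundamentalRep (Fin 2)) β'] ≤
      (Fintype.card (Edge 3 L) : ℝ) * frobNorm E ^ 2 / (1 - 12 * |β'|) := by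
  classical
  haveI := secondCountableTopology_su2
  haveI := borelSpace_config L
  set μ : Measure (GaugeConfig 3 L (Matrix.specialUnitaryGroup (Fin 2) ℂ)) := wilsonMeasure (d := 3) (L := L) (fundamentalRep (Fin 2)) β'
    with hμ
  haveI : IsProbabilityMeasure μ :=
    isProbabilityMeasure_wilsonMeasure (d := 3) (L := L) (fundamentalRep (Fin 2)) (continuous_fundamentalRep (Fin 2)) β'
  -- the real link coordinates and the total link field as a (linear) function of them
  set co : GaugeConfig 3 L (Matrix.specialUnitaryGroup (Fin 2) ℂ) → (Edge 3 L × Fin 2 × Fin 2 × Bool → ℝ) :=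
    fun V q => (fun z : ℂ => if q.2.2.2 then z.im else z.re) ((fundamentalRep (Fin 2) (V q.1) : Matrix (Fin 2) (Fin 2) ℂ) q.2.1 q.2.2.1)
    with hco
  set f : (Edge 3 L × Fin 2 × Fin 2 × Bool → ℝ) → ℝ :=
    fun c => ∑ e : Edge 3 L, ∑ i : Fin 2, ∑ j : Fin 2, (c (e, i, j, false) * (E i j).re + c (e, i, j, true) * (E i j).im) with hf
  have hfC : ContDiff ℝ 3 f := by
    refine ContDiff.sum fun e _ => ContDiff.sum fun i _ => ContDiff.sum fun j _ => ?_
    exact ((contDiff_apply ℝ ℝ (e, i, j, false)).mul contDiff_const).add ((contDiff_apply ℝ ℝ (e, i, j, true)).mul contDiff_const)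
  have hval : ∀ V : GaugeConfig 3 L (Matrix.specialUnitaryGroup (Fin 2) ℂ),
      f (co V) = ∑ e, (((V e : Matrix.specialUnitaryGroup (Fin 2) ℂ) : Matrix (Fin 2) (Fin 2) ℂ) * Eᴴ).trace.re := by
    intro V
    simp only [hf, hco, Bool.false_eq_true, if_false, if_true, fundamentalRep_apply, re_trace_mul_conjTranspose_eq_sum]
  have hval' : ∀ V : GaugeConfig 3 L (Matrix.specialUnitaryGroup (Fin 2) ℂ),
      f (co V) = ∑ e, linkHSComponent (fundamentalRep (Fin 2)) E e V := fun V => (hval V).trans rfl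
  -- Lipschitz in each link with constant `‖E‖_F`
  have hLip : ∀ (e : Edge 3 L) (y y' : GaugeConfig 3 L (Matrix.specialUnitaryGroup (Fin 2) ℂ)), (∀ e', e' ≠ e → y e' = y' e') →
      |f (co y) - f (co y')| ≤ frobNorm E * frobNorm ((y e : Matrix (Fin 2) (Fin 2) ℂ) - (y' e : Matrix (Fin 2) (Fin 2) ℂ)) := by
    intro e y y' hyy'
    rw [hval, hval, ← Finset.sum_sub_distrib, Finset.sum_eq_single e]
    · rw [show (((y e : Matrix.specialUnitaryGroup (Fin 2) ℂ) : Matrix (Fin 2) (Fin 2) ℂ) * Eᴴ).trace.re -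
          (((y' e : Matrix.specialUnitaryGroup (Fin 2) ℂ) : Matrix (Fin 2) (Fin 2) ℂ) * Eᴴ).trace.re =
          ((((y e : Matrix.specialUnitaryGroup (Fin 2) ℂ) : Matrix (Fin 2) (Fin 2) ℂ) -
            ((y' e : Matrix.specialUnitaryGroup (Fin 2) ℂ) : Matrix (Fin 2) (Fin 2) ℂ)) * Eᴴ).trace.re by
        rw [Matrix.sub_mul, Matrix.trace_sub, Complex.sub_re]]
      refine (abs_re_trace_mul_le _ _).trans (le_of_eq ?_)
      rw [frobNorm_conjTranspose, mul_comm]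
    · intro e' _ hne
      rw [hyy' e' hne, sub_self]
    · intro h; exact absurd (Finset.mem_univ e) h
  have h : ∫ V, (f (co V) - ∫ V', f (co V') ∂μ) ^ 2 ∂μ ≤ (∑ _e : Edge 3 L, frobNorm E ^ 2) / (1 - 12 * |β'|) :=
    wilson_variance_le_of_linkLipschitz_uniform L β' hβ f hfC (ℓ := fun _ => frobNorm E) (fun _ => frobNorm_nonneg E) hLip
  simp_rw [hval'] at h
  have hXm : AEMeasurable (fun V : GaugeConfig 3 L (Matrix.specialUnitaryGroup (Fin 2) ℂ) =>
      ∑ e, linkHSComponent (fundamentalRep (Fin 2)) E e V) μ := by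
    have hc : Continuous fun V : GaugeConfig 3 L (Matrix.specialUnitaryGroup (Fin 2) ℂ) => f (co V) :=
      hfC.continuous.comp (continuous_coords (L := L))
    have hfun : (fun V : GaugeConfig 3 L (Matrix.specialUnitaryGroup (Fin 2) ℂ) => f (co V)) =
        fun V => ∑ e, linkHSComponent (fundamentalRep (Fin 2)) E e V := funext hval'
    rw [hfun] at hc
    exact hc.measurable.aemeasurable
  rw [variance_eq_integral hXm]
  refine h.trans (le_of_eq ?_)
  rw [Finset.sum_const, Finset.card_univ, nsmul_eq_mul, mul_div_assoc]

/-! ## §4. Shen–Zhu–Zhu's Corollary 4.7 for `SU(2)`, `d = 3`, on every torus -/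

/-- ★★★ **Susceptibility bound for the link field (SZZ Cor. 4.7), `SU(2)`, `d = 3`, sharp window, EVERY volume**: for the periodic Wilson
measure on `(ℤ/L)³` at tree coupling `|β'| < 1/12`, every link `e₀` and every matrix `E`,
`0 ≤ Σ_{e ∈ E⁺_{Λ_L}} Cov_{L,β'}(⟨Q_{e₀},E⟩, ⟨Q_e,E⟩) ≤ ‖E‖_F²/(1 − 12|β'|)`  (the row sum is `Var(Σ_e⟨Q_e,E⟩)/|E⁺|` by symmetry).
SZZ print `γ/K_S = 2/(1 − 32|β|)` for unit `E` at `β' = 2β`; here the tree's normalisation gives `1/(1 − 12|β'|)`.  The Yang–Mills mass gap is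
NOT proved. [cite: ShenZhuZhu2022, Corollary 4.7] -/
theorem torus_linkSusceptibility_su2 {β' : ℝ} (hβ : |β'| < 1 / 12) (L : ℕ) [NeZero L] (e₀ : Edge 3 L) (E : Matrix (Fin 2) (Fin 2) ℂ) :
    0 ≤ ∑ e, cov[linkHSComponent (fundamentalRep (Fin 2)) E e₀, linkHSComponent (fundamentalRep (Fin 2)) E e;
        wilsonMeasure (d := 3) (L := L) (fundamentalRep (Fin 2)) β'] ∧
    ∑ e, cov[linkHSComponent (fundamentalRep (Fin 2)) E e₀, linkHSComponent (fundamentalRep (Fin 2)) E e;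
        wilsonMeasure (d := 3) (L := L) (fundamentalRep (Fin 2)) β'] ≤ frobNorm E ^ 2 / (1 - 12 * |β'|) := by
  haveI : IsProbabilityMeasure (wilsonMeasure (d := 3) (L := L) (fundamentalRep (Fin 2)) β') :=
    isProbabilityMeasure_wilsonMeasure (d := 3) (L := L) (fundamentalRep (Fin 2)) (continuous_fundamentalRep (Fin 2)) β'
  obtain ⟨g, hg⟩ : ∃ g : Matrix.specialUnitaryGroup (Fin 2) ℂ → ℝ,
      g = fun U => ((fundamentalRep (Fin 2) U : Matrix (Fin 2) (Fin 2) ℂ) * Eᴴ).trace.re := ⟨_, rfl⟩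
  have hgc : Continuous g := by
    rw [hg]
    exact Complex.continuous_re.comp ((continuous_id.matrix_trace).comp
      (((continuous_fundamentalRep (n := Fin 2)).matrix_mul continuous_const)))
  have hX : ∀ e : Edge 3 L, linkHSComponent (fundamentalRep (Fin 2)) E e =
      fun V : GaugeConfig 3 L (Matrix.specialUnitaryGroup (Fin 2) ℂ) => g (V e) := by
    intro e; funext V; rw [hg, linkHSComponent_apply]
  have hcard : (0 : ℝ) < Fintype.card (Edge 3 L) := by exact_mod_cast Fintype.card_pos_iff.2 ⟨e₀⟩
  have hkey := variance_sum_linkObs_eq (d := 3) (L := L) (fundamentalRep (Fin 2)) (continuous_fundamentalRep (Fin 2)) β' hgc e₀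
  have hvar := torus_linkFieldSum_variance_su2 hβ L E
  have hnn : 0 ≤ Var[fun V : GaugeConfig 3 L (Matrix.specialUnitaryGroup (Fin 2) ℂ) => ∑ e, g (V e);
      wilsonMeasure (d := 3) (L := L) (fundamentalRep (Fin 2)) β'] := variance_nonneg _ _
  simp only [hX] at hvar ⊢
  rw [hkey] at hvar hnn
  constructor
  · exact le_of_mul_le_mul_left (by rw [mul_zero]; exact hnn) hcard
  · rw [mul_div_assoc] at hvar
    exact le_of_mul_le_mul_left hvar hcard

/-- ★★ **Off-diagonal susceptibility (SZZ Cor. 4.7, "in particular")**: `|Σ_{e ≠ e₀} Cov_{L,β'}(⟨Q_{e₀},E⟩, ⟨Q_e,E⟩)| ≤ ‖E‖_F²/(1 − 12|β'|)` — the full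
row sum and the diagonal term `Var(⟨Q_{e₀},E⟩)` both lie in `[0, ‖E‖_F²/(1 − 12|β'|)]` (SZZ print `2γ/K_S` by the triangle inequality).  The
Yang–Mills mass gap is NOT proved. [cite: ShenZhuZhu2022, Corollary 4.7] -/
theorem torus_linkSusceptibility_offDiag_su2 {β' : ℝ} (hβ : |β'| < 1 / 12) (L : ℕ) [NeZero L] (e₀ : Edge 3 L) (E : Matrix (Fin 2) (Fin 2) ℂ) :
    |∑ e ∈ Finset.univ.erase e₀, cov[linkHSComponent (fundamentalRep (Fin 2)) E e₀, linkHSComponent (fundamentalRep (Fin 2)) E e;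
        wilsonMeasure (d := 3) (L := L) (fundamentalRep (Fin 2)) β']| ≤ frobNorm E ^ 2 / (1 - 12 * |β'|) := by
  classical
  haveI := secondCountableTopology_su2
  haveI := borelSpace_config L
  set μ : Measure (GaugeConfig 3 L (Matrix.specialUnitaryGroup (Fin 2) ℂ)) := wilsonMeasure (d := 3) (L := L) (fundamentalRep (Fin 2)) β'
    with hμ
  haveI : IsProbabilityMeasure μ :=
    isProbabilityMeasure_wilsonMeasure (d := 3) (L := L) (fundamentalRep (Fin 2)) (continuous_fundamentalRep (Fin 2)) β'
  obtain ⟨h0, h1⟩ := torus_linkSusceptibility_su2 hβ L e₀ E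
  have hv1 := torus_linkField_variance_su2 hβ L e₀ E
  have hv0 : 0 ≤ Var[linkHSComponent (fundamentalRep (Fin 2)) E e₀; μ] := variance_nonneg _ _
  have hXm : AEMeasurable (linkHSComponent (fundamentalRep (Fin 2)) E e₀ :
      GaugeConfig 3 L (Matrix.specialUnitaryGroup (Fin 2) ℂ) → ℝ) μ := by
    have hgc : Continuous fun U : Matrix.specialUnitaryGroup (Fin 2) ℂ =>
        ((fundamentalRep (Fin 2) U : Matrix (Fin 2) (Fin 2) ℂ) * Eᴴ).trace.re :=
      Complex.continuous_re.comp ((continuous_id.matrix_trace).comp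
        (((continuous_fundamentalRep (n := Fin 2)).matrix_mul continuous_const)))
    exact (hgc.measurable.comp (measurable_pi_apply e₀)).aemeasurable
  rw [Finset.sum_erase_eq_sub (Finset.mem_univ e₀), covariance_self hXm]
  rw [abs_sub_le_iff]
  constructor <;> linarith

/-! ## §5. The parameterised shape and the named fact -/

/-- ★★★ **`SZZLinkSusceptibilityBound (fundamentalRep (Fin 2)) 3 (2β) 2 K`** for every 't Hooft coupling `|β| < 1/24` and every constant
`0 < K ≤ 1 − 24|β|` (tree coupling `β' = 2β`, `|β'| < 1/12`): on every torus `(ℤ/L)³`, `L > 1`, every link `e₀`, every unit `E`,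
`Σ_e Cov(⟨Q_{e₀},E⟩, ⟨Q_e,E⟩) ≤ 2/K` and `|Σ_{e ≠ e₀} Cov(…)| ≤ 4/K` (we even have `1/(1 − 24|β|)` for both).  The Yang–Mills mass gap is NOT
proved. [cite: ShenZhuZhu2022, Corollary 4.7] -/
theorem szzLinkSusceptibilityBound_su2 {β : ℝ} (hβ : |β| < 1 / 24) {K : ℝ} (hK : 0 < K) (hKle : K ≤ 1 - 24 * |β|) :
    SZZLinkSusceptibilityBound (fundamentalRep (Fin 2)) 3 (((2 : ℕ) : ℝ) * β) 2 K := by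
  intro L _ _ e₀ E hE
  have hβ' : |((2 : ℕ) : ℝ) * β| < 1 / 12 := by
    rw [abs_mul, Nat.cast_ofNat, abs_two]; linarith
  have hK' : 1 - 12 * |((2 : ℕ) : ℝ) * β| = 1 - 24 * |β| := by
    rw [abs_mul, Nat.cast_ofNat, abs_two]; ring
  have hn : frobNorm E ^ 2 = 1 := by rw [frobNorm_sq_eq_re_trace, Matrix.trace_mul_comm, hE]
  have hKpos : 0 < 1 - 24 * |β| := by linarith
  obtain ⟨_, h1⟩ := torus_linkSusceptibility_su2 hβ' L e₀ E
  have h2 := torus_linkSusceptibility_offDiag_su2 hβ' L e₀ E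
  rw [hn, hK'] at h1 h2
  have hcmp : 1 / (1 - 24 * |β|) ≤ 1 / K := one_div_le_one_div_of_le hK hKle
  have hK2 : 1 / K ≤ 2 / K := by
    rw [div_le_div_iff_of_pos_right hK]; norm_num
  constructor
  · exact h1.trans (hcmp.trans hK2)
  · calc |∑ e ∈ Finset.univ.erase e₀, cov[linkHSComponent (fundamentalRep (Fin 2)) E e₀, linkHSComponent (fundamentalRep (Fin 2)) E e;
            wilsonMeasure (d := 3) (L := L) (fundamentalRep (Fin 2)) (((2 : ℕ) : ℝ) * β)]|
          ≤ 1 / (1 - 24 * |β|) := h2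
      _ ≤ 1 / K := hcmp
      _ ≤ 2 * 2 / K := by rw [div_le_div_iff_of_pos_right hK]; norm_num

/-- ★★★ **The named fact `shenZhuZhu_linkSusceptibility 3 2` (Shen–Zhu–Zhu CMP 400 (2023), Corollary 4.7) is a THEOREM**: the `SU(2)` conjunct on
SZZ's window `|β| < 1/32` with the printed constants `2/K_S`, `4/K_S`, `K_S = 1 − 32|β| ≤ 1 − 24|β|`; the `SO(2)` conjunct is vacuous (SZZ's
threshold `1/(32(d−1)) − 1/(16N(d−1))` vanishes at `N = 2`).  STRONG coupling, fixed finite tori; the Yang–Mills mass gap is NOT proved.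
[cite: ShenZhuZhu2022, Corollary 4.7] -/
theorem shenZhuZhu_linkSusceptibility_su2_d3 : shenZhuZhu_linkSusceptibility 3 2 := by
  refine ⟨fun _ _ β hβ => ?_, fun _ _ β hβ => ?_⟩
  · have hT : szzThresholdSU 3 = 1 / 32 := by norm_num [szzThresholdSU]
    rw [hT] at hβ
    have hKS : szzBakryEmeryConstSU 2 3 β = 1 - 32 * |β| := by
      simp only [szzBakryEmeryConstSU]; push_cast; ring
    rw [hKS]
    exact szzLinkSusceptibilityBound_su2 (by linarith) (by linarith [abs_nonneg β]) (by linarith [abs_nonneg β])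
  · have hT : szzThresholdSO 2 3 = 0 := by norm_num [szzThresholdSO]
    rw [hT] at hβ
    exact absurd hβ (not_lt.2 (abs_nonneg β))

end Summit.QuantumFields.YangMills.Theorems.ColdStartUniversality

end
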